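import Literature.Barriers.AtomisticToContinuum.OneDimensionalHardCoreRods
import Literature.Barriers.AtomisticToContinuum.OneDimensionalHardCoreRodsLenard
import HarnessLib

/-!
# Hard rods: the excluded-volume map in the tagged frame (pointwise identities)

`Literature/Barriers/AtomisticToContinuum/` (D-0021 barrier catalogue), sub-problem
`BoseEinsteinCondensation`; part of the typed proof of the rod barrier `OneDimensionalHardRods`
(`OneDimensionalHardCoreRods.lean`, eighth audit of `OneDimensionalHardCore`, 2026-08-16).

Faithfulness plumbing, step (1) of the paper proof, pointwise. Tag a rod at `0`, let the
spectators be `X : Fin n → ℝ` with chart coordinates in `(0, L)`, and put the tagged rod a second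
time at `s`. With the spectator ranks `srank_j = #{i : X_i < X_j}`, the number of crossed
spectators `m = #{j : X_j < s}` (`crossedCount`) and the compressed spectator coordinates
`w_j = X_j − a(1 + srank_j)` (`rodSpectator`), the rod coordinates of the two tagged configurations
are `κ(X, 0) = (w, 0)` (`rodCompress_snoc_zero`) and `κ(X, s) = (w + a·1[X_j < s], s − ma)`
(`rodCompress_snoc`). If both configurations are STRICTLY admissible (`RodTagged`: the open
conditions used by the change of variables), a packing lemma for points pairwise `≥ a` apart
(`mul_card_le_of_separated`) puts every `w_j` in the compressed domain `D_t = [0, t−a] ∪ (t, L']`,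
`t = s − ma`, `L' = L − (n+1)a`, with `X_j < s ↔ w_j ≤ t − a` (`rodSpectator_mem_rodDomain`,
`lt_iff_rodSpectator_le`), so that the two-point rod integrand is the compressed Girardeau integrand
of `rodCompressedDensity`: `Ψ(X,0)Ψ(X,s) = (L'/L) Ψ_TG(w,0) Ψ_TG(T_t w, t)`
(`rodState_snoc_mul_rodState_snoc`).

## References

* [MazzantiEtAl2008] F. Mazzanti et al., Phys. Rev. Lett. 100 (2008) 020401: Eqs. (2)–(3), (7).
* [Nagamiya1940] T. Nagamiya, Proc. Phys.-Math. Soc. Japan 22 (1940) 705.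
-/

noncomputable section

open Finset
open scoped BigOperators Real

namespace Literature.Barriers.AtomisticToContinuum.BoseGas

section Compress

variable {n : ℕ} {L a s : ℝ}

/-! #### A packing lemma -/

/-- **Packing lemma.** If the values `f i`, `i ∈ S`, lie in `[u, v]` and are pairwise at distance
`≥ a ≥ 0`, then `a·#S ≤ v − u + a`. [folklore] -/
theorem mul_card_le_of_separated {ι : Type*} [DecidableEq ι] (f : ι → ℝ)
    (S : Finset ι) : ∀ (u v : ℝ), (∀ i ∈ S, ∀ j ∈ S, i ≠ j → a ≤ |f i - f j|) →
      (∀ i ∈ S, u ≤ f i ∧ f i ≤ v) → S.Nonempty → a * S.card ≤ v - u + a := by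
  induction S using Finset.strongInduction with
  | H S ih =>
    intro u v hsep hin hne
    obtain ⟨i₀, hi₀, hmax⟩ := S.exists_max_image f hne
    by_cases hcard : S.card = 1
    · rw [hcard, Nat.cast_one, mul_one]
      linarith [(hin i₀ hi₀).1, (hin i₀ hi₀).2]
    · have hpos : 0 < S.card := Finset.card_pos.mpr hne
      have hS' : (S.erase i₀).Nonempty := by
        rw [← Finset.card_pos, Finset.card_erase_of_mem hi₀]
        omega
      have hsub : S.erase i₀ ⊂ S := Finset.erase_ssubset hi₀
      have h := ih (S.erase i₀) hsub u (f i₀ - a)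
        (fun i hi j hj hij => hsep i (Finset.mem_of_mem_erase hi) j (Finset.mem_of_mem_erase hj) hij)
        (fun i hi => by
          have hiS := Finset.mem_of_mem_erase hi
          have hne' : i ≠ i₀ := Finset.ne_of_mem_erase hi
          refine ⟨(hin i hiS).1, ?_⟩
          have h1 := hsep i hiS i₀ hi₀ hne'
          have h2 := hmax i hiS
          rw [abs_of_nonpos (by linarith)] at h1
          linarith) hS'
      rw [Finset.card_erase_of_mem hi₀, Nat.cast_sub hpos, Nat.cast_one] at h
      linarith [(hin i₀ hi₀).2]

/-- Strict form: if moreover all values are `> u`, then `a·#S < v − u + a`. [folklore] -/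
theorem mul_card_lt_of_separated {ι : Type*} [DecidableEq ι] (f : ι → ℝ)
    (S : Finset ι) (u v : ℝ) (hsep : ∀ i ∈ S, ∀ j ∈ S, i ≠ j → a ≤ |f i - f j|)
    (hin : ∀ i ∈ S, u < f i ∧ f i ≤ v) (hne : S.Nonempty) : a * S.card < v - u + a := by
  obtain ⟨i₁, hi₁, hmin⟩ := S.exists_min_image f hne
  have h := mul_card_le_of_separated f S (f i₁) v hsep
    (fun i hi => ⟨hmin i hi, (hin i hi).2⟩) hne
  linarith [(hin i₁ hi₁).1]

/-! #### Ranks in the tagged configurations -/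

/-- The number of crossed spectators `m = #{j : X_j < s}`. [folklore] -/
def crossedCount (X : Fin n → ℝ) (s : ℝ) : ℕ := (Finset.univ.filter fun j : Fin n => X j < s).card

/-- The compressed spectator coordinates `w_j = X_j − a(1 + #{i : X_i < X_j})`. [folklore] -/
def rodSpectator (a : ℝ) (X : Fin n → ℝ) : Fin n → ℝ := fun j => X j - a * (1 + rodRank X j)

/-- Rank of the tagged point in `(X, c)`: the number of spectators below `c`. [folklore] -/
theorem rodRank_snoc_last (X : Fin n → ℝ) (c : ℝ) :
    rodRank (Fin.snoc X c : Fin (n + 1) → ℝ) (Fin.last n) = crossedCount X c := by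
  unfold rodRank crossedCount
  rw [Finset.card_filter, Finset.card_filter, Fin.sum_univ_castSucc]
  simp [Fin.snoc_castSucc, Fin.snoc_last]

/-- Rank of a spectator in `(X, c)`: its spectator rank, plus one if the tagged point is below it.
[folklore] -/
theorem rodRank_snoc_castSucc (X : Fin n → ℝ) (c : ℝ) (j : Fin n) :
    rodRank (Fin.snoc X c : Fin (n + 1) → ℝ) j.castSucc = rodRank X j + (if c < X j then 1 else 0) := by
  unfold rodRank
  rw [Finset.card_filter, Finset.card_filter, Fin.sum_univ_castSucc]
  simp [Fin.snoc_castSucc, Fin.snoc_last]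

/-- **Rod coordinates of `(X, 0)`**: if every spectator is above `0`, then
`κ(X, 0) = (w, 0)`. [cite: MazzantiEtAl2008, text after Eq. (3)] -/
theorem rodCompress_snoc_zero (a : ℝ) {X : Fin n → ℝ} (hX : ∀ j, 0 < X j) :
    rodCompress a (Fin.snoc X 0 : Fin (n + 1) → ℝ) = Fin.snoc (rodSpectator a X) 0 := by
  funext i
  induction i using Fin.lastCases with
  | last =>
    simp only [rodCompress, rodRank_snoc_last, Fin.snoc_last]
    have h0 : crossedCount X 0 = 0 := by
      unfold crossedCount
      rw [Finset.card_eq_zero, Finset.filter_eq_empty_iff]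
      intro j _; exact not_lt.mpr (hX j).le
    rw [h0]; simp
  | cast j =>
    simp only [rodCompress, rodRank_snoc_castSucc, Fin.snoc_castSucc, rodSpectator, if_pos (hX j)]
    push_cast; ring

/-- **Rod coordinates of `(X, s)`**: if no spectator sits at `s`, then
`κ(X, s) = (w + a·1[X < s], s − ma)`. [cite: MazzantiEtAl2008, text after Eq. (3)] -/
theorem rodCompress_snoc (a : ℝ) {X : Fin n → ℝ} {s : ℝ} (hXs : ∀ j, X j ≠ s) :
    rodCompress a (Fin.snoc X s : Fin (n + 1) → ℝ) =
      Fin.snoc (fun j => rodSpectator a X j + a * (if X j < s then 1 else 0))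
        (s - a * crossedCount X s) := by
  funext i
  induction i using Fin.lastCases with
  | last => simp only [rodCompress, rodRank_snoc_last, Fin.snoc_last]
  | cast j =>
    simp only [rodCompress, rodRank_snoc_castSucc, Fin.snoc_castSucc, rodSpectator]
    rcases lt_or_gt_of_ne (hXs j) with h | h
    · rw [if_neg (not_lt.mpr h.le), if_pos h]; push_cast; ring
    · rw [if_pos h, if_neg (not_lt.mpr h.le)]; push_cast; ring

/-! #### Where the compressed spectators live -/

/-- **Strict joint admissibility** of the two tagged configurations `(X, 0)` and `(X, s)` — the open
conditions on which the change of variables acts: all spectators in `(a, L − a)`, strictly more than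
`a` away from `s` and from each other. [folklore] -/
structure RodTagged (n : ℕ) (L a s : ℝ) (X : Fin n → ℝ) : Prop where
  left : ∀ j, a < X j
  right : ∀ j, X j < L - a
  away : ∀ j, X j < s - a ∨ s + a < X j
  sep : ∀ i j, i ≠ j → a < |X i - X j|

namespace RodTagged

variable {X : Fin n → ℝ}

/-- Spectators are above the tagged rod at `0`. [folklore] -/
theorem pos (h : RodTagged n L a s X) (ha : 0 ≤ a) (j : Fin n) : 0 < X j := lt_of_le_of_lt ha (h.left j)

/-- No spectator sits at `s`. [folklore] -/
theorem ne (h : RodTagged n L a s X) (ha : 0 ≤ a) (j : Fin n) : X j ≠ s := by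
  rcases h.away j with h' | h' <;> intro heq <;> linarith

/-- No ties among the spectators. [folklore] -/
theorem inj (h : RodTagged n L a s X) (ha : 0 ≤ a) {i j : Fin n} (hij : i ≠ j) : X i ≠ X j := by
  intro heq
  have := h.sep i j hij
  rw [heq, sub_self, abs_zero] at this
  linarith

/-- `#{k : X_j ≤ X_k} = n − srank_j`. [folklore] -/
theorem card_filter_ge (X : Fin n → ℝ) (j : Fin n) :
    ((Finset.univ.filter fun k : Fin n => X j ≤ X k).card : ℝ) = n - rodRank X j := by
  unfold rodRank
  have hc : (Finset.univ.filter fun k : Fin n => X j ≤ X k) = (Finset.univ.filter fun k : Fin n => X k < X j)ᶜ := by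
    ext k; simp [not_lt]
  rw [hc, Finset.card_compl, Fintype.card_fin, Nat.cast_sub]
  exact (Finset.card_filter_le _ _).trans (by simp)

/-- (C) `0 ≤ w_j`: the `srank_j + 1` spectators `≤ X_j` are `≥ a` apart in `[a, X_j]`. [folklore] -/
theorem rodSpectator_nonneg (h : RodTagged n L a s X) (ha : 0 ≤ a) (j : Fin n) : 0 ≤ rodSpectator a X j := by
  classical
  set S := Finset.univ.filter fun k : Fin n => X k ≤ X j with hS
  have hcard : (S.card : ℝ) = rodRank X j + 1 := by
    have h1 : S = (Finset.univ.filter fun k : Fin n => X k < X j) ∪ {j} := by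
      ext k
      simp only [hS, Finset.mem_filter, Finset.mem_univ, true_and, Finset.mem_union, Finset.mem_singleton]
      constructor
      · intro hk
        rcases lt_or_eq_of_le hk with hk | hk
        · exact Or.inl hk
        · right; by_contra hkj; exact h.inj ha hkj hk
      · rintro (hk | rfl)
        · exact hk.le
        · exact le_rfl
    rw [h1, Finset.card_union_of_disjoint (by simp), Finset.card_singleton]
    unfold rodRank; push_cast; rfl
  have hpack := mul_card_le_of_separated X S a (X j)
    (fun i _ k _ hik => (h.sep i k hik).le)
    (fun i hi => ⟨(h.left i).le, by simpa [hS] using hi⟩)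
    ⟨j, by simp [hS]⟩
  unfold rodSpectator
  rw [hcard] at hpack
  nlinarith

/-- (D) `w_j ≤ L'`: the `n − srank_j` spectators `≥ X_j` are `≥ a` apart in `[X_j, L − a]`. [folklore] -/
theorem rodSpectator_le (h : RodTagged n L a s X) (j : Fin n) :
    rodSpectator a X j ≤ L - ((n + 1 : ℕ) : ℝ) * a := by
  classical
  set S := Finset.univ.filter fun k : Fin n => X j ≤ X k with hS
  have hcard : (S.card : ℝ) = n - rodRank X j := card_filter_ge X j
  have hpack := mul_card_le_of_separated X S (X j) (L - a)
    (fun i _ k _ hik => (h.sep i k hik).le)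
    (fun i hi => ⟨by simpa [hS] using hi, (h.right i).le⟩)
    ⟨j, by simp [hS]⟩
  unfold rodSpectator
  rw [hcard] at hpack
  push_cast
  nlinarith

/-- (A) crossed spectators: `X_j < s → w_j ≤ t − a`, `t = s − ma`. [folklore] -/
theorem rodSpectator_le_of_lt (h : RodTagged n L a s X) (ha : 0 ≤ a) {j : Fin n} (hj : X j < s) :
    rodSpectator a X j ≤ s - a * crossedCount X s - a := by
  classical
  set S := Finset.univ.filter fun k : Fin n => X j ≤ X k ∧ X k < s with hS
  have hcard : (S.card : ℝ) + rodRank X j = crossedCount X s := by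
    have h1 : S ∪ (Finset.univ.filter fun k : Fin n => X k < X j) =
        Finset.univ.filter fun k : Fin n => X k < s := by
      ext k
      simp only [hS, Finset.mem_union, Finset.mem_filter, Finset.mem_univ, true_and]
      constructor
      · rintro (⟨_, hk⟩ | hk)
        · exact hk
        · exact hk.trans hj
      · intro hk
        by_cases hkj : X k < X j
        · exact Or.inr hkj
        · exact Or.inl ⟨not_lt.mp hkj, hk⟩
    have h2 : Disjoint S (Finset.univ.filter fun k : Fin n => X k < X j) := by
      rw [Finset.disjoint_left]; intro k hk hk'
      simp only [hS, Finset.mem_filter, Finset.mem_univ, true_and] at hk hk'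
      linarith [hk.1]
    unfold rodRank crossedCount
    rw [← h1, Finset.card_union_of_disjoint h2]; push_cast; ring
  have hpack := mul_card_le_of_separated X S (X j) (s - a)
    (fun i _ k _ hik => (h.sep i k hik).le)
    (fun i hi => by
      simp only [hS, Finset.mem_filter, Finset.mem_univ, true_and] at hi
      refine ⟨hi.1, ?_⟩
      rcases h.away i with h' | h'
      · exact h'.le
      · linarith [hi.2])
    ⟨j, by simp [hS, hj]⟩
  unfold rodSpectator
  have : (S.card : ℝ) = crossedCount X s - rodRank X j := by linarith
  rw [this] at hpack
  nlinarith

/-- (B) uncrossed spectators: `s < X_j → t < w_j` (strictly, by strict admissibility). [folklore] -/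
theorem lt_rodSpectator_of_gt (h : RodTagged n L a s X) (ha : 0 ≤ a) {j : Fin n} (hj : s < X j) :
    s - a * crossedCount X s < rodSpectator a X j := by
  classical
  set S := Finset.univ.filter fun k : Fin n => s < X k ∧ X k ≤ X j with hS
  have hcard : (crossedCount X s : ℝ) + S.card = rodRank X j + 1 := by
    have h1 : (Finset.univ.filter fun k : Fin n => X k < s) ∪ S =
        (Finset.univ.filter fun k : Fin n => X k < X j) ∪ {j} := by
      ext k
      simp only [hS, Finset.mem_union, Finset.mem_filter, Finset.mem_univ, true_and,
        Finset.mem_singleton]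
      constructor
      · rintro (hk | ⟨hk, hk'⟩)
        · exact Or.inl (hk.trans hj)
        · rcases lt_or_eq_of_le hk' with hk'' | hk''
          · exact Or.inl hk''
          · right; by_contra hkj; exact h.inj ha hkj hk''
      · rintro (hk | rfl)
        · rcases lt_or_gt_of_ne (h.ne ha k) with hks | hks
          · exact Or.inl hks
          · exact Or.inr ⟨hks, hk.le⟩
        · exact Or.inr ⟨hj, le_rfl⟩
    have h2 : Disjoint (Finset.univ.filter fun k : Fin n => X k < s) S := by
      rw [Finset.disjoint_left]; intro k hk hk'
      simp only [hS, Finset.mem_filter, Finset.mem_univ, true_and] at hk hk'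
      linarith [hk'.1]
    have h3 : Disjoint (Finset.univ.filter fun k : Fin n => X k < X j) {j} := by simp
    unfold rodRank crossedCount
    have := congrArg Finset.card h1
    rw [Finset.card_union_of_disjoint h2, Finset.card_union_of_disjoint h3, Finset.card_singleton] at this
    exact_mod_cast this
  have hpack := mul_card_lt_of_separated X S (s + a) (X j)
    (fun i _ k _ hik => (h.sep i k hik).le)
    (fun i hi => by
      simp only [hS, Finset.mem_filter, Finset.mem_univ, true_and] at hi
      refine ⟨?_, hi.2⟩
      rcases h.away i with h' | h'
      · linarith [hi.1]
      · exact h')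
    ⟨j, by simp [hS, hj]⟩
  unfold rodSpectator
  have : (S.card : ℝ) = rodRank X j + 1 - crossedCount X s := by linarith
  rw [this] at hpack
  nlinarith

/-- **Crossing is read off the compressed coordinate**: `X_j < s ↔ w_j ≤ t − a`. [folklore] -/
theorem lt_iff_rodSpectator_le (h : RodTagged n L a s X) (ha : 0 ≤ a) (j : Fin n) :
    X j < s ↔ rodSpectator a X j ≤ s - a * crossedCount X s - a := by
  constructor
  · exact h.rodSpectator_le_of_lt ha
  · intro hw
    by_contra hj
    have hj' : s < X j := lt_of_le_of_ne (not_lt.mp hj) (h.ne ha j).symm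
    have := h.lt_rodSpectator_of_gt ha hj'
    linarith

/-- **The compressed spectators lie in the compressed domain** `D_t`, `t = s − ma`. [folklore] -/
theorem rodSpectator_mem_rodDomain (h : RodTagged n L a s X) (ha : 0 ≤ a) (j : Fin n) :
    rodSpectator a X j ∈ rodDomain (L - ((n + 1 : ℕ) : ℝ) * a) a (s - a * crossedCount X s) := by
  unfold rodDomain
  rcases lt_or_gt_of_ne (h.ne ha j) with hj | hj
  · left
    exact ⟨h.rodSpectator_nonneg ha j, by linarith [h.rodSpectator_le_of_lt ha hj]⟩
  · right
    exact ⟨h.lt_rodSpectator_of_gt ha hj, h.rodSpectator_le j⟩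

/-- The tagged displacement `t = s − ma` is non-negative. [folklore] -/
theorem crossed_nonneg (h : RodTagged n L a s X) (ha : 0 ≤ a) (hs : 0 ≤ s) :
    0 ≤ s - a * crossedCount X s := by
  by_cases hm : crossedCount X s = 0
  · rw [hm]; simpa using hs
  · obtain ⟨j, hj⟩ : ∃ j, X j < s := by
      by_contra hno
      push Not at hno
      apply hm
      unfold crossedCount
      rw [Finset.card_eq_zero, Finset.filter_eq_empty_iff]
      intro j _; exact not_lt.mpr (hno j)
    have h1 := h.rodSpectator_le_of_lt ha hj
    have h2 := h.rodSpectator_nonneg ha j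
    linarith

/-- The tagged displacement satisfies `t ≤ L' + a`. [folklore] -/
theorem crossed_le (h : RodTagged n L a s X) (ha : 0 ≤ a) (hsL : s ≤ L) :
    s - a * crossedCount X s ≤ L - ((n + 1 : ℕ) : ℝ) * a + a := by
  have hm : (crossedCount X s : ℝ) ≤ n := by
    unfold crossedCount
    exact_mod_cast (Finset.card_filter_le _ _).trans (by simp)
  by_cases hall : crossedCount X s = n
  · rw [hall]; push_cast; nlinarith
  · -- some spectator is uncrossed
    obtain ⟨j, hj⟩ : ∃ j, s < X j := by
      by_contra hno
      push Not at hno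
      apply hall
      unfold crossedCount
      have : (Finset.univ.filter fun j : Fin n => X j < s) = Finset.univ := by
        rw [Finset.filter_eq_self]
        intro j _; exact lt_of_le_of_ne (hno j) (h.ne ha j)
      rw [this, Finset.card_univ, Fintype.card_fin]
    have h1 := h.lt_rodSpectator_of_gt ha hj
    have h2 := h.rodSpectator_le j
    linarith

/-! #### Admissibility of the two tagged configurations -/

/-- `(X, 0)` is admissible. [folklore] -/
theorem rodAdmissible_snoc_zero (h : RodTagged n L a s X) (ha : 0 ≤ a) :
    rodAdmissible L a (Fin.snoc X 0 : Fin (n + 1) → ℝ) := by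
  intro i k hik
  unfold ringDist
  induction i using Fin.lastCases with
  | last =>
    induction k using Fin.lastCases with
    | last => exact absurd rfl hik
    | cast k =>
      simp only [Fin.snoc_last, Fin.snoc_castSucc, zero_sub, abs_neg]
      rw [abs_of_pos (h.pos ha k)]
      exact le_min (h.left k).le (by linarith [h.right k])
  | cast i =>
    induction k using Fin.lastCases with
    | last =>
      simp only [Fin.snoc_last, Fin.snoc_castSucc, sub_zero]
      rw [abs_of_pos (h.pos ha i)]
      exact le_min (h.left i).le (by linarith [h.right i])
    | cast k =>
      simp only [Fin.snoc_castSucc]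
      have hik' : i ≠ k := fun heq => hik (by rw [heq])
      refine le_min (h.sep i k hik').le ?_
      have : |X i - X k| ≤ L - 2 * a := by
        rw [abs_le]; constructor <;> linarith [h.left i, h.right i, h.left k, h.right k]
      linarith

/-- `(X, s)` is admissible (for `s ∈ [0, L]`). [folklore] -/
theorem rodAdmissible_snoc (h : RodTagged n L a s X) (ha : 0 ≤ a) (hs0 : 0 ≤ s) (hsL : s ≤ L) :
    rodAdmissible L a (Fin.snoc X s : Fin (n + 1) → ℝ) := by
  intro i k hik
  unfold ringDist
  have hsp : ∀ k : Fin n, a ≤ |s - X k| ∧ a ≤ L - |s - X k| := by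
    intro k
    constructor
    · rcases h.away k with h' | h'
      · rw [abs_of_pos (by linarith)]; linarith
      · rw [abs_of_neg (by linarith)]; linarith
    · have : |s - X k| ≤ L - a := by
        rw [abs_le]; constructor <;> linarith [h.left k, h.right k]
      linarith
  induction i using Fin.lastCases with
  | last =>
    induction k using Fin.lastCases with
    | last => exact absurd rfl hik
    | cast k =>
      simp only [Fin.snoc_last, Fin.snoc_castSucc]
      exact le_min (hsp k).1 (hsp k).2
  | cast i =>
    induction k using Fin.lastCases with
    | last =>
      simp only [Fin.snoc_last, Fin.snoc_castSucc, abs_sub_comm (X i) s]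
      exact le_min (hsp i).1 (hsp i).2
    | cast k =>
      simp only [Fin.snoc_castSucc]
      have hik' : i ≠ k := fun heq => hik (by rw [heq])
      refine le_min (h.sep i k hik').le ?_
      have : |X i - X k| ≤ L - 2 * a := by
        rw [abs_le]; constructor <;> linarith [h.left i, h.right i, h.left k, h.right k]
      linarith

/-! #### The two-point rod integrand in compressed coordinates -/

/-- **The excluded-volume map, pointwise.** On strictly admissible tagged configurations,
`Ψ(X, 0) Ψ(X, s) = (L'/L) Ψ_TG(w, 0) Ψ_TG(T_t w, t)` with `w` the compressed spectators,
`t = s − ma`, `T_t` the rod shift. [cite: MazzantiEtAl2008, Eqs. (2)–(3)] -/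
theorem rodState_snoc_mul_rodState_snoc (h : RodTagged n L a s X) (hL : 0 < L) (ha : 0 ≤ a)
    (hLp : 0 ≤ L - ((n + 1 : ℕ) : ℝ) * a) (hs0 : 0 ≤ s) (hsL : s ≤ L) :
    rodState (n + 1) L a (Fin.snoc X 0) * rodState (n + 1) L a (Fin.snoc X s) =
      (L - ((n + 1 : ℕ) : ℝ) * a) / L *
        (girardeauState (n + 1) (L - ((n + 1 : ℕ) : ℝ) * a) (Fin.snoc (rodSpectator a X) 0) *
          girardeauState (n + 1) (L - ((n + 1 : ℕ) : ℝ) * a)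
            (Fin.snoc (fun i => rodShift a (s - a * crossedCount X s) (rodSpectator a X i))
              (s - a * crossedCount X s))) := by
  set Lp : ℝ := L - ((n + 1 : ℕ) : ℝ) * a with hLpdef
  set t : ℝ := s - a * crossedCount X s with ht
  have hT : (fun j => rodSpectator a X j + a * (if X j < s then 1 else 0)) =
      fun i => rodShift a t (rodSpectator a X i) := by
    funext j
    unfold rodShift
    by_cases hj : X j < s
    · rw [if_pos hj, if_pos ((h.lt_iff_rodSpectator_le ha j).mp hj), mul_one]
    · rw [if_neg hj, if_neg (fun hw => hj ((h.lt_iff_rodSpectator_le ha j).mpr hw)), mul_zero, add_zero]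
  unfold rodState
  rw [Set.indicator_of_mem (show (Fin.snoc X 0 : Fin (n + 1) → ℝ) ∈
      {y : Fin (n + 1) → ℝ | rodAdmissible L a y} from h.rodAdmissible_snoc_zero ha),
    Set.indicator_of_mem (show (Fin.snoc X s : Fin (n + 1) → ℝ) ∈
      {y : Fin (n + 1) → ℝ | rodAdmissible L a y} from h.rodAdmissible_snoc ha hs0 hsL)]
  rw [rodCompress_snoc_zero a (h.pos ha), rodCompress_snoc a (h.ne ha), hT]
  have hsq : Real.sqrt (Lp / L) * Real.sqrt (Lp / L) = Lp / L :=
    Real.mul_self_sqrt (div_nonneg hLp hL.le)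
  calc Real.sqrt (Lp / L) * girardeauState (n + 1) Lp (Fin.snoc (rodSpectator a X) 0) *
        (Real.sqrt (Lp / L) * girardeauState (n + 1) Lp
          (Fin.snoc (fun i => rodShift a t (rodSpectator a X i)) t))
      = (Real.sqrt (Lp / L) * Real.sqrt (Lp / L)) *
          (girardeauState (n + 1) Lp (Fin.snoc (rodSpectator a X) 0) *
            girardeauState (n + 1) Lp (Fin.snoc (fun i => rodShift a t (rodSpectator a X i)) t)) := by
        ring
    _ = _ := by rw [hsq]

end RodTagged

end Compress

end Literature.Barriers.AtomisticToContinuum.BoseGas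

end
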